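import Summits.CriticalPhenomena.PercolationContinuityZ3.Theorems.Transplant.PlanarSkeletonFrmQuasiDefs
import Summits.CriticalPhenomena.PercolationContinuityZ3.Theorems.Transplant.SkelFrmQuasiBParamsCorrKGLen3
import Summits.CriticalPhenomena.PercolationContinuityZ3.Theorems.Transplant.SkelFrmBParamsCorrKGLen3
import Summits.CriticalPhenomena.PercolationContinuityZ3.Theorems.Transplant.SkelFrmQuasi1ParamsLBL
import Summits.CriticalPhenomena.PercolationContinuityZ3.Theorems.Transplant.SkelFrmQuasi1ParamsPO
import Summits.CriticalPhenomena.PercolationContinuityZ3.Theorems.Transplant.SkelFrmQuasiBParamsCorrKG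
import Summits.CriticalPhenomena.PercolationContinuityZ3.Theorems.Transplant.SkelFrmQuasiBParamsCorrKG0
import Summits.CriticalPhenomena.PercolationContinuityZ3.Theorems.Transplant.SkelFrmQuasiBParamsCorrKGLenY
import Summits.CriticalPhenomena.PercolationContinuityZ3.Theorems.Transplant.SkelFrmQuasiBParamsCorrKGY
import Summits.CriticalPhenomena.PercolationContinuityZ3.Theorems.Transplant.SkelFrmQuasiBParamsLF
import HarnessLib
import Summits.CriticalPhenomena.PercolationContinuityZ3.Theorems.Transplant.SkelFrmBParamsCorrKGLen3S
/-!
# GEN-Q PORT (WAVE-Q table v0.8 section 2, row G073, U-level L11; captain R-6/R-7 2026-08-27: carrier token swap `PlanarSkeletonFrmFrom ↦ PlanarSkeletonFrmQuasi`)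
# of the tree module «Transplant/SkelFrmFromBParamsCorrKGLen3S» (sha256 f4e495eca8bc6fd3…) onto the quasi-step carrier `PlanarSkeletonFrmQuasi` (p507026): «SkelFrmQuasiBParamsCorrKGLen3S»

ORIGINAL TITLE: N2 (frames-only node `SamePDropOfSkeletonFrmFrom₁`, OPEN) — (ζ″) under J23/(R-44) and (R-46): THE y′-CORRIDOR BUDGET WITH SLACK, `N + 1 + (m₁+1) + (m₂+1) + 64 ≤ LfQ`

builds on p205010 (kernel theorem, internal audit signed; external expert review pending) — nothing in this file uses p205010; NOTHING is claimed about any open node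
((N3-b), the end state).  Lane `prim-bschramm`, seat `prim-bschramm-stmt` (gen 33; GEN-Q column pen; tool = captain gen-1 g4's port_genq.py R-14 --cone + p3-g30's T1 patch).  Helper file (`--supports stmt-CriticalPhenomena-4575 --as helper`).
PORT RULES (U-wave r1–r4 re-used, GEN-Q hunk classes of p3-g29 #6136): declaration order, names and proof texts are those of «SkelFrmFromBParamsCorrKGLen3S», byte-identical except
(i) the carrier token `PlanarSkeletonFrmFrom ↦ PlanarSkeletonFrmQuasi` in binders, `namespace`/`end` lines and qualified names (module names `SkelFrmFrom… ↦ SkelFrmQuasi…`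
in imports of already-ported rows); (ii) `Φ.step ↦ Φ.qstep` with the called Steps lemma replaced by its `…Q`/`_q` twin and the cost `Φ.M` threaded (none in this file unless
listed below); (iii) `Φ.cyl_connected ↦ Φ.cyl_reach` readers (none unless listed); (iv) graph-ball radii / window floors ×`Φ.M` (none unless listed).  Carrier-free
residents stay imported/exported from the original «SkelFrmBParamsCorrKGLen3S» exactly as in the FrmFrom port.  Docstrings and citations are the original's.

-/

open scoped Classical

noncomputable section

namespace Summit.CriticalPhenomena.PercolationContinuityZ3.Theorems.Transplant

namespace Skelφ

open Literature.Probability.Percolation Literature.Probability.LatticeModels SimpleGraph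

section Budget3S

variable {n ℓ : ℕ} {hs v : ℤ} {R' ρ q W : ℕ}

end Budget3S

end Skelφ

/-! ## At the values of record (`ρ := 0`): the successor residual floors and the two budgets -/

namespace PlanarSkeletonFrmQuasi

namespace NegB

open Literature.Probability.Percolation Literature.Probability.LatticeModels SimpleGraph
open SkelConc (Consts)
open Skelφ (shearUnit kgSL kgSLY kgM₁ kgM₂ kgM₁Y kgM₂Y KGRows KGYRows)
open Neg

section Values3S

variable (κ : Consts) {V : Type} [DecidableEq V] [Countable V] {G : SimpleGraph V} [G.LocallyFinite] (Φ : PlanarSkeletonFrmQuasi G) (t : V) (p : unitInterval)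
  (D : Skelφ.StepI.DataNS V) (g f mk qx Wx : ℕ)

/-- **THE N-CORRIDOR FITS THE BUDGET WITH 64 STEPS TO SPARE** (`ρ := 0`, `KGResY3`): `N + 1 + (m₁+1) + (m₂+1) + 64 ≤ LfQ κ.K₀` — p3-g17's (R-46) root
y′-corridor spends `1 + (27 + 2 + 8) + 1 ≤ 64` extra steps on bridge + x-prefix. [this work] -/
theorem kgSchedNY_le_LfQ3_slack (κ : Consts) {V : Type} [DecidableEq V] [Countable V] {G : SimpleGraph V} [G.LocallyFinite] (Φ : PlanarSkeletonFrmQuasi G) (t : V) (p : unitInterval) (D : Skelφ.StepI.DataNS V) (g : ℕ) (f : ℕ) (mk : ℕ) (qx : ℕ) (Wx : ℕ) (hN : EqNumL κ Φ t p D g f) (hg : gFloorKG κ Φ t p D mk ≤ g) (hx : KGResY3 κ Φ t p D g f qx Wx) :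
    kgNYv0 κ Φ t p D g f mk qx Wx + 1 +
        (kgM₁Y (nL κ Φ t p D g f) (vL κ Φ t p D g f) (kgR κ Φ t p D mk) 0 (kgWY κ Φ t p D g f Wx) (kgNYv0 κ Φ t p D g f mk qx Wx) + 1) +
        (kgM₂Y (nL κ Φ t p D g f) (ℓL κ Φ t p D g f) (hL κ Φ t p D g f) (vL κ Φ t p D g f) (kgR κ Φ t p D mk) 0 (kgqY κ Φ t p D g f qx)
          (kgWY κ Φ t p D g f Wx) (kgNYv0 κ Φ t p D g f mk qx Wx) + 1) + 64 ≤ LfQ κ.K₀ := by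
  have H := kgYRows0_of κ Φ t p D g f mk qx Wx hN hg
  obtain ⟨hSn, hS, hR8, hbig, hρP⟩ := kgY_floors κ Φ t p D g f mk hN hg
  have hNle := kgNYv0_le κ Φ t p D g f mk qx Wx hN hg
  have hK := (Skelφ.NegPrm.forty_le_Kcell κ.K₀).1
  have hK' : (40 : ℤ) ≤ (Neg.K κ : ℤ) := by unfold Neg.K; exact_mod_cast hK
  have hNz : ((kgNYv0 κ Φ t p D g f mk qx Wx : ℕ) : ℤ) ≤ 21 * (Neg.K κ : ℤ) + 2 := by exact_mod_cast hNle
  have hW : ((kgWY κ Φ t p D g f Wx : ℕ) : ℤ) ≤ 102 * (nL κ Φ t p D g f : ℤ) := by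
    have hWx : Wx ≤ 100 * nL κ Φ t p D g f := hx.hWx
    unfold kgWY; push_cast
    have : ((Wx : ℕ) : ℤ) ≤ 100 * (nL κ Φ t p D g f : ℤ) := by exact_mod_cast hWx
    linarith
  have hq : ((kgqY κ Φ t p D g f qx : ℕ) : ℤ) ≤ 41 * kgSLY (nL κ Φ t p D g f) (ℓL κ Φ t p D g f) (hL κ Φ t p D g f) + 2 := by
    have hqx := hx.hqx
    have hPd := Skelφ.natDiv_le_kgSLY (one_le_of_eqNumL κ Φ t p D g f hN).1 (ℓL κ Φ t p D g f) (hL κ Φ t p D g f)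
    unfold kgqY
    push_cast [Nat.cast_add] at hPd ⊢
    linarith
  have hb := H.kgSchedNY_budget3_slack hSn hS hR8 hW hq hρP hbig hK' (kgNYv0 κ Φ t p D g f mk qx Wx) hNz
  have hZ : ((kgNYv0 κ Φ t p D g f mk qx Wx + 1 +
        (kgM₁Y (nL κ Φ t p D g f) (vL κ Φ t p D g f) (kgR κ Φ t p D mk) 0 (kgWY κ Φ t p D g f Wx) (kgNYv0 κ Φ t p D g f mk qx Wx) + 1) +
        (kgM₂Y (nL κ Φ t p D g f) (ℓL κ Φ t p D g f) (hL κ Φ t p D g f) (vL κ Φ t p D g f) (kgR κ Φ t p D mk) 0 (kgqY κ Φ t p D g f qx)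
          (kgWY κ Φ t p D g f Wx) (kgNYv0 κ Φ t p D g f mk qx Wx) + 1 + 64) : ℕ) : ℤ) ≤ ((LfQ κ.K₀ : ℕ) : ℤ) := by
    rw [LfQ_eq]; push_cast; linarith
  exact_mod_cast hZ

end Values3S

end NegB

end PlanarSkeletonFrmQuasi

end Summit.CriticalPhenomena.PercolationContinuityZ3.Theorems.Transplant

end
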